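import Mathlib
import Summits.AtomisticToContinuum.BoseEinsteinCondensation.Theses.BECThomsonPrinciple

/-!
# Sketch — crux-ideate stmt-AtomisticToContinuum-9482 (`BECThomsonPrinciple.GDTransfer`), ideator 3, round 1

First lemmas of the two idea cards (statements only; they must elaborate, they need not be proved):

* `ChordLimitKLS` — card `slack-first-phase-averaged-kls`: the real-variable kernel of the
  variational Kennedy–Lieb–Shastry step for a `δ`-near-minimiser: from the chord inequality along
  `Ψ + tζ` (zeroth-order source value `a₀ = O(√δ)`, first variation `e₁ = O(√(δ q))`,
  normalisation `D(t) = 1 + 2tr + t²m`) one gets `x² ≤ 4 C q + η` once `δ ≤ δ₀(C,Q,Y,R,M,η)`.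
* `EscortedProjectionVanishes` — card `escorted-projection-healing`: a one-body cell average
  escorted by pair weights that vanish on close pairs maps functions vanishing on the contact set
  to functions vanishing on the contact set (the atomic step of anatomical healing).
* `EscortCost` — the price of the escort: `x_l` is free under the cell average, so the escort
  changes `P_l Φ` only on a set of relative measure `(N-1)·|B_{a+ε}|/L³ = (4π/3)ρ(a+ε)³·(1-1/N)`.
-/

namespace Summit.AtomisticToContinuum.BoseEinsteinCondensation.Cruxes.GDTransfer.Ideator3

open MeasureTheory
open Literature.MathematicalPhysics.QuantumManyBody.BoseGas

/-- Card `slack-first-phase-averaged-kls`, first lemma (pure real analysis). Dictionary: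
`C ↔ C_GD·L²/‖n‖²` (chord constant at wave number `k`), `δ ↔` energy slack of the near-minimiser
`Ψ`, `x ↔ X = ⟨ζ,Λ†Ψ⟩+⟨Ψ,Λ†ζ⟩` (phase-averaged: `ω(ΛΛ†+Λ†Λ)`), `q ↔ ⟨ζ,(H-E₀)ζ⟩`,
`a₀ ↔ ⟨Ψ,Λ†Ψ⟩`, `e₁ ↔ 2Re⟨ζ,(H-E₀)Ψ⟩` (Cauchy–Schwarz for the form `H-E₀ ≥ 0`),
`y ↔ ⟨ζ,Λ†ζ⟩`, `r ↔ Re⟨ζ,Ψ⟩`, `m ↔ ‖ζ‖²`; `Y R M Q` are the `N`-dependent a-priori bounds, which is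
why `δ₀` may depend on `N` — allowed by `∃ δ` after `∀ᶠ N` in `PeriodicBEC`. -/
def ChordLimitKLS : Prop :=
  ∀ C Q Y R M η : ℝ, 0 < C → 0 ≤ Q → 0 ≤ M → 0 < η →
    ∃ δ₀ : ℝ, 0 < δ₀ ∧ ∀ δ : ℝ, 0 < δ → δ ≤ δ₀ →
      ∀ x a₀ e₁ y r m q : ℝ,
        |a₀| ≤ 2 * Real.sqrt (C * δ) → 0 ≤ q → q ≤ Q → |e₁| ≤ 2 * Real.sqrt (δ * q) →
        |y| ≤ Y → |r| ≤ R → 0 ≤ m → m ≤ M →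
        (∀ t s : ℝ, 0 ≤ t → 0 ≤ s → 0 < 1 + 2 * t * r + t ^ 2 * m →
            s * |a₀ + t * x + t ^ 2 * y| ≤
              δ + t * e₁ + t ^ 2 * q + C * s ^ 2 * (1 + 2 * t * r + t ^ 2 * m)) →
        x ^ 2 ≤ 4 * C * q + η

/-- Card `escorted-projection-healing`, first lemma: the cell average of particle `l`
(`P_l Φ (X) = L⁻³ ∫_cell Φ(X with x_l ↦ y) dy`, as in the inline `let P` of `GaussianDominationCan`)
escorted by pair weights `w (x_l) (x_m)`, `m ≠ l`, that vanish on `close` pairs, vanishes on the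
contact set `{X | ∃ i ≠ j, close (X i) (X j)}` whenever `Φ` does. (`close x y` := some periodic
image of `x - y` has norm `≤ a` covers the hard core of `periodizedPotential`.) -/
def EscortedProjectionVanishes : Prop :=
  ∀ (N : ℕ) (L : ℝ) (close : Space → Space → Prop) (w : Space → Space → ℂ)
    (Φ : Config N → ℂ) (l : Fin N),
    (∀ x y, close x y → w x y = 0) → (∀ x y, close x y → close y x) →
    (∀ X : Config N, (∃ i j : Fin N, i ≠ j ∧ close (X i) (X j)) → Φ X = 0) →
    ∀ X : Config N, (∃ i j : Fin N, i ≠ j ∧ close (X i) (X j)) →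
      (∏ m ∈ Finset.univ.erase l, w (X l) (X m)) *
          (((L ^ 3)⁻¹ : ℝ) • ∫ y in cell L, Φ (Function.update X l y)) = 0

/-- Card `escorted-projection-healing`, cost of the escort: with weights `w x y = χ(x - y)`,
`0 ≤ χ ≤ 1`, `χ = 1` off the ball of radius `a + ε` (periodised if need be), the escort changes
`P_l Φ` only where some `x_m`, `m ≠ l`, is within `a + ε` of `x_l`; since `P_l Φ` does not
depend on `x_l`, the loss is at most `(N - 1)·|B(0,a+ε)|/L³` of `∫_cell |Φ|²` — no dependence
on the correlations of `Φ`, hence no "innocent damage". -/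
def EscortCost : Prop :=
  ∀ (N : ℕ) (L b : ℝ) (χ : Space → ℝ) (Φ : PeriodicTrialState N L) (l : Fin N),
    0 < L → 0 ≤ b → Measurable χ → (∀ z, 0 ≤ χ z ∧ χ z ≤ 1) → (∀ z, b ≤ ‖z‖ → χ z = 1) →
    ∫⁻ X in cellN N L,
        (‖(1 - ∏ m ∈ Finset.univ.erase l, (χ (X l - X m) : ℂ)) *
            (((L ^ 3)⁻¹ : ℝ) • ∫ y in cell L, Φ.ψ (Function.update X l y))‖₊ : ENNReal) ^ 2 ≤
      ((N - 1 : ℕ) : ENNReal) * (volume (Metric.closedBall (0 : Space) b) / ENNReal.ofReal (L ^ 3)) *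
        ∫⁻ X in cellN N L, (‖Φ.ψ X‖₊ : ENNReal) ^ 2

/-- The crux these cards serve (by name, for the record). -/
example : Prop := Summit.AtomisticToContinuum.BoseEinsteinCondensation.Theses.BECThomsonPrinciple.GDTransfer

end Summit.AtomisticToContinuum.BoseEinsteinCondensation.Cruxes.GDTransfer.Ideator3
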